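import Literature.AnabelianGeometry.EtaleTheta.SettingModel
import Literature.AnabelianGeometry.EtaleTheta.ConstantMultipleRigidity
import Mathlib.Topology.Instances.ZMod
import HarnessLib

/-!
# A model of the [EtTh] §1 root, part F: the Def. 1.7 layer `MuTwoSetting` over the model

Mochizuki, *The étale theta function …*, Publ. RIMS **45** (2009) [EtTh], §1, Def. 1.7, PRIMS PDF p. 27
(printed 253) [cite: MochizukiEtTh2009, Def 1.7 p.27]: under "(I) `K = K̈`", "the Galois covering
`Ẍ^log → X^log` of degree 4 determined by the multiplication by 2 map", "`X^log → C^log` … the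
stack-theoretic quotient by ±1", "`Gal(Ẍ/C) ≅ (ℤ/2ℤ)³`", "`ε_μ ∈ Gal(Ẍ/X)`", "`ε_± ∈ Gal(Ẍ/C)`". Layer L2 of
the abc-iut cell, seat abc-iut-L2-t1 (root owner); SIXTH file of the explicit model (vacuity lane,
consistency evidence only — see `SettingModelHeisenberg.lean`, `SettingModel.lean`).

The interface `MuTwoSetting p` (`ConstantMultipleRigidity.lean`) — over which Def. 1.7, Prop. 1.8,
Def. 1.9, Thm. 1.10 and `Discharge/Sec1Def17Coverings`, `Sec1Prop18*`, `Sec1StandardType` are stated —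
is INHABITED over `ThetaSetting.model p`: `q̈ = p ∈ ℚ_p = K` (condition (I) holds by the choice
`q_X := p²`); `Π^tp_C := Π^tp_X × ℤ/2` with `Π^tp_X ↪ Π^tp_C` the first factor (index 2, normal, open);
`Π^tp_Ẍ := {a- and b-exponents even} × Γ` (index 4, the Heisenberg preimage of `2ℤ × 2ℤ`), so that
`Π^tp_C/Π^tp_Ẍ ≅ (ℤ/2)³` (every square lies in `Π^tp_Ẍ`), `Π^tp_Ÿ ≤ Π^tp_Ẍ`; `ε_μ := b`, `ε_± :=` the
generator of the extra `ℤ/2`. RESULT: `MuTwoSetting.model p`, `MuTwoSetting.model_toThetaSetting`,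
`MuTwoSetting.nonempty`; with abc-iut-L2-t1 gen 2's `exists_isAdmissibleEpsZ` every Def. 1.7 / Thm. 1.10
statement quantifies over an inhabited domain. No instances on existing types; no Prop facts; nothing
of [EtTh] asserted; no side taken on [IUTchIII] Cor. 3.12.
-/

noncomputable section

namespace Literature.AnabelianGeometry.EtaleTheta.SettingModel

open Literature.AnabelianGeometry.SemiGraphs
open CategoryTheory

variable (p : ℕ) [Fact p.Prime]

/-! ### The mod-2 lattice: `Π^tp_Ẍ` -/

/-- The `(x, y) mod n` homomorphism `Heis ℤ → ℤ/n × ℤ/n` (multiplicatively written).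
[cite: MochizukiEtTh2009, Def 1.7 p.27] -/
def Heis.xyMod (n : ℕ) : Heis ℤ →* Multiplicative (ZMod n × ZMod n) where
  toFun g := Multiplicative.ofAdd (((g.x : ℤ) : ZMod n), ((g.y : ℤ) : ZMod n))
  map_one' := by simp
  map_mul' g h := by
    rw [← ofAdd_add, Prod.mk_add_mk]
    simp

/-- `heisMod n := {n ∣ x, n ∣ y} ≤ Heis ℤ` (for `n = 2`: the image of `Δ_Ẍ`, "multiplication by 2").
[cite: MochizukiEtTh2009, Def 1.7 p.27] -/
def heisMod (n : ℕ) : Subgroup (Heis ℤ) := (Heis.xyMod n).ker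

/-- [cite: MochizukiEtTh2009, Def 1.7 p.27] -/
theorem mem_heisMod_iff (n : ℕ) (g : Heis ℤ) : g ∈ heisMod n ↔ (n : ℤ) ∣ g.x ∧ (n : ℤ) ∣ g.y := by
  simp [heisMod, Heis.xyMod, MonoidHom.mem_ker, Prod.ext_iff, ZMod.intCast_zmod_eq_zero_iff_dvd]

/-- `Heis.xyMod n` is surjective. [cite: MochizukiEtTh2009, Def 1.7 p.27] -/
theorem Heis.xyMod_surjective (n : ℕ) : Function.Surjective (Heis.xyMod n) := by
  intro t
  obtain ⟨x, hx⟩ := ZMod.intCast_surjective (Multiplicative.toAdd t).1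
  obtain ⟨y, hy⟩ := ZMod.intCast_surjective (Multiplicative.toAdd t).2
  refine ⟨⟨x, y, 0⟩, ?_⟩
  simp [Heis.xyMod, hx, hy]

/-- `[Heis ℤ : heisMod n] = n²`. [cite: MochizukiEtTh2009, Def 1.7 p.27] -/
theorem index_heisMod (n : ℕ) : (heisMod n).index = n * n := by
  rw [heisMod, Subgroup.index_ker, MonoidHom.range_eq_top.mpr (Heis.xyMod_surjective n),
    Subgroup.card_top]
  show Nat.card (ZMod n × ZMod n) = n * n
  rw [Nat.card_prod, Nat.card_zmod]

/-- `Δ_Ẍ := ` the words with even `a`- and `b`-exponents — the subgroup of `F₂` of "the Galois covering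
`Ẍ^log → X^log` of degree 4 determined by the multiplication by 2 map". [cite: MochizukiEtTh2009, Def 1.7 p.27] -/
def deltaXdd : Subgroup F₂ := (heisMod 2).comap heisHom

/-- `[Δ_X : Δ_Ẍ] = 4`. [cite: MochizukiEtTh2009, Def 1.7 p.27] -/
theorem index_deltaXdd : deltaXdd.index = 4 := by
  rw [deltaXdd, Subgroup.index_comap_of_surjective _ heisHom_surjective, index_heisMod]

/-- `Δ_{Y_2} ≤ Δ_Ẍ` (`x = 0`, `2 ∣ y`). [cite: MochizukiEtTh2009, Def 1.7 p.27] -/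
theorem deltaYN_two_le_deltaXdd : deltaYN 2 ≤ deltaXdd := by
  rintro g ⟨hx, hy⟩
  rw [deltaXdd, Subgroup.mem_comap, mem_heisMod_iff]
  exact ⟨by simp [hx], by exact_mod_cast hy⟩

/-- Squares lie in `Δ_Ẍ`. [cite: MochizukiEtTh2009, Def 1.7 p.27] -/
theorem mul_self_mem_deltaXdd (g : F₂) : g * g ∈ deltaXdd := by
  rw [deltaXdd, Subgroup.mem_comap, map_mul, mem_heisMod_iff]
  exact ⟨by simp [← two_mul], by simp [← two_mul]⟩

/-- `a ∉ Δ_Ẍ`. [cite: MochizukiEtTh2009, Def 1.7 p.27] -/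
theorem of_zero_not_mem_deltaXdd : FreeGroup.of (0 : Fin 2) ∉ deltaXdd := by
  rw [deltaXdd, Subgroup.mem_comap, heisHom_of_zero, mem_heisMod_iff]
  norm_num

/-- `a·b⁻¹ ∉ Δ_Ẍ` (so `ε_Z := a` is admissible: `ε_Z ≠ ε_μ`). [cite: MochizukiEtTh2009, Def 1.7 p.27] -/
theorem of_zero_mul_of_one_inv_not_mem_deltaXdd :
    FreeGroup.of (0 : Fin 2) * (FreeGroup.of 1)⁻¹ ∉ deltaXdd := by
  rw [deltaXdd, Subgroup.mem_comap, map_mul, map_inv, heisHom_of_zero, heisHom_of_one, mem_heisMod_iff]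
  norm_num

/-- `b ∉ Δ_Ẍ`. [cite: MochizukiEtTh2009, Def 1.7 p.27] -/
theorem of_one_not_mem_deltaXdd : FreeGroup.of (1 : Fin 2) ∉ deltaXdd := by
  rw [deltaXdd, Subgroup.mem_comap, heisHom_of_one, mem_heisMod_iff]
  norm_num

/-! ### `Π^tp_C := Π^tp_X × ℤ/2` -/

/-- `Π^tp_C := Π^tp_X × ℤ/2` (discrete) — the model of the tempered fundamental group of the orbicurve
`C = X/±1`. [cite: MochizukiEtTh2009, Def 1.7 p.27] -/
abbrev PiC : Type := PiTp p × Multiplicative (ZMod 2)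

/-- `Π^tp_X ↪ Π^tp_C`, the first factor. [cite: MochizukiEtTh2009, Def 1.7 p.27] -/
def inclXM : PiTp p →* PiC p := MonoidHom.inl (PiTp p) (Multiplicative (ZMod 2))

/-- `Π^tp_Ẍ := Δ_Ẍ × Γ ≤ Π^tp_X`. [cite: MochizukiEtTh2009, Def 1.7 p.27] -/
def Xdd : Subgroup (PiTp p) := (deltaXdd.comap Del.val).prod ⊤

/-- The image of `Π^tp_X` in `Π^tp_C` is `Π^tp_X × 1`. [cite: MochizukiEtTh2009, Def 1.7 p.27] -/
theorem range_inclXM : (inclXM p).range = (⊤ : Subgroup (PiTp p)).prod ⊥ := by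
  ext x
  constructor
  · rintro ⟨y, rfl⟩
    exact ⟨trivial, (Subgroup.mem_bot).mpr rfl⟩
  · rintro ⟨-, hx⟩
    exact ⟨x.1, Prod.ext rfl ((Subgroup.mem_bot.mp hx).symm)⟩

/-- `A ↦ A × 1` under `inclX`. [folklore] -/
private theorem map_inclXM (A : Subgroup (PiTp p)) : A.map (inclXM p) = A.prod ⊥ := by
  ext x
  constructor
  · rintro ⟨y, hy, rfl⟩
    exact ⟨hy, (Subgroup.mem_bot).mpr rfl⟩
  · rintro ⟨hx1, hx2⟩
    exact ⟨x.1, hx1, Prod.ext rfl ((Subgroup.mem_bot.mp hx2).symm)⟩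

/-! ### The inhabitant of `MuTwoSetting p` -/

/-- **The Def. 1.7 layer over the model.** An explicit inhabitant of `MuTwoSetting p`
(`ConstantMultipleRigidity.lean`) extending `ThetaSetting.model p`: (I) `q̈ = p ∈ K = ℚ_p`;
`Π^tp_C := Π^tp_X × ℤ/2`; `Π^tp_Ẍ := Δ_Ẍ × Γ` with `Δ_Ẍ` the words of even `a`- and `b`-exponent;
`ε_μ := b`; `ε_± :=` the generator of `ℤ/2`. Consistency evidence only. [cite: MochizukiEtTh2009, Def 1.7 p.27] -/
abbrev _root_.Literature.AnabelianGeometry.EtaleTheta.MuTwoSetting.model : MuTwoSetting p where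
  toThetaSetting := ThetaSetting.model p
  sqrtqX_mem_K := natCast_mem _ p
  GtpC := PiC p
  inclX := inclXM p
  continuous_inclX := continuous_of_discreteTopology
  injective_inclX := fun a b h => congrArg Prod.fst h
  isOpen_range_inclX := isOpen_discrete _
  range_inclX_normal := by rw [range_inclXM]; infer_instance
  index_range_inclX := by
    rw [range_inclXM, Subgroup.index_prod, Subgroup.index_top, Subgroup.index_bot, one_mul]
    show Nat.card (ZMod 2) = 2
    exact Nat.card_zmod 2
  GtpXdd := Xdd p
  index_GtpXdd := by
    rw [Xdd, Subgroup.index_prod, Subgroup.index_top, mul_one,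
      Subgroup.index_comap_of_surjective _ Del.val_bijective.2, index_deltaXdd]
  map_GtpXdd_normal := by
    rw [map_inclXM, Xdd]
    haveI : (heisMod 2).Normal := inferInstanceAs (Heis.xyMod 2).ker.Normal
    haveI : deltaXdd.Normal := Subgroup.Normal.comap inferInstance _
    haveI : (deltaXdd.comap Del.val).Normal := Subgroup.Normal.comap inferInstance _
    infer_instance
  sq_mem_GtpXdd g := by
    rw [map_inclXM, Xdd, Subgroup.mem_prod, Subgroup.mem_prod, Subgroup.mem_bot]
    refine ⟨⟨?_, trivial⟩, ?_⟩
    · show Del.val (g.1.1 * g.1.1) ∈ deltaXdd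
      rw [map_mul]
      exact mul_self_mem_deltaXdd _
    · show g.2 * g.2 = 1
      have h2 : ∀ t : Multiplicative (ZMod 2), t * t = 1 := by decide
      exact h2 g.2
  GtpYdd_le_GtpXdd := by
    intro x hx
    have h1 : x ∈ YN p (2 * 1) := hx.1
    have h2 : Del.val x.1 ∈ deltaYN 2 := h1.1
    exact ⟨deltaYN_two_le_deltaXdd h2, trivial⟩
  epsMu := inclXM p (Del.ofF₂ (FreeGroup.of 1), 1)
  epsMu_mem := ⟨_, rfl⟩
  epsMu_not_mem := by
    rw [map_inclXM]
    rintro ⟨⟨h1, -⟩, -⟩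
    exact of_one_not_mem_deltaXdd h1
  epsPM := (1, Multiplicative.ofAdd 1)
  epsPM_not_mem := by
    rintro ⟨y, hy⟩
    have h2 : ((inclXM p) y).2 = Multiplicative.ofAdd 1 := congrArg Prod.snd hy
    have h1 : ((inclXM p) y).2 = 1 := rfl
    rw [h1] at h2
    exact absurd h2 (by decide)

/-- The model's Def. 1.7 layer sits over the model of the root. [cite: MochizukiEtTh2009, Def 1.7 p.27] -/
theorem _root_.Literature.AnabelianGeometry.EtaleTheta.MuTwoSetting.model_toThetaSetting :
    (MuTwoSetting.model p).toThetaSetting = ThetaSetting.model p := rfl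

/-- … hence satisfies the guard `IsEtThOrigin`. [cite: MochizukiEtTh2009, §1 p.12] -/
theorem _root_.Literature.AnabelianGeometry.EtaleTheta.MuTwoSetting.model_isEtThOrigin :
    (MuTwoSetting.model p).toThetaSetting.IsEtThOrigin :=
  ThetaSetting.model_isEtThOrigin p

/-- **`ε_Z := a` is an admissible choice** in the model (Def. 1.7: "a nontrivial element
`ε_Z ∈ Gal(Ẍ/X)` which is `≠ ε_μ`"): so the curves `Ẋ`, `Ċ` of type `(1, μ₂)`, `(1, μ₂)±` exist over the
model. [cite: MochizukiEtTh2009, Def 1.7 p.27] -/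
theorem _root_.Literature.AnabelianGeometry.EtaleTheta.MuTwoSetting.model_isAdmissibleEpsZ :
    (MuTwoSetting.model p).IsAdmissibleEpsZ (inclXM p (Del.ofF₂ (FreeGroup.of 0), 1)) := by
  refine ⟨⟨_, rfl⟩, ?_, ?_⟩
  · show inclXM p (Del.ofF₂ (FreeGroup.of 0), 1) ∉ (Xdd p).map (inclXM p)
    rw [map_inclXM]
    rintro ⟨⟨h1, -⟩, -⟩
    exact of_zero_not_mem_deltaXdd h1
  · show inclXM p (Del.ofF₂ (FreeGroup.of 0), 1) * (inclXM p (Del.ofF₂ (FreeGroup.of 1), 1))⁻¹ ∉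
      (Xdd p).map (inclXM p)
    rw [map_inclXM, ← map_inv, ← map_mul]
    rintro ⟨⟨h1, -⟩, -⟩
    exact of_zero_mul_of_one_inv_not_mem_deltaXdd h1

/-- **Joint satisfiability of the Def. 1.7 interface, the root guard and admissibility**: there is a
`MuTwoSetting p` whose underlying theta setting satisfies `IsEtThOrigin` and which admits an admissible
`ε_Z` — every statement of `ConstantMultipleRigidity.lean` / `Discharge/Sec1Def17Coverings.lean` /
`Sec1Prop18*.lean` over `M : MuTwoSetting p` is non-vacuously quantified. [cite: MochizukiEtTh2009, Def 1.7 p.27] -/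
theorem _root_.Literature.AnabelianGeometry.EtaleTheta.MuTwoSetting.exists_isEtThOrigin_and_isAdmissibleEpsZ :
    ∃ M : MuTwoSetting p, M.toThetaSetting.IsEtThOrigin ∧ ∃ εZ : M.GtpC, M.IsAdmissibleEpsZ εZ :=
  ⟨MuTwoSetting.model p, MuTwoSetting.model_isEtThOrigin p, _, MuTwoSetting.model_isAdmissibleEpsZ p⟩

end Literature.AnabelianGeometry.EtaleTheta.SettingModel

end
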